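import Summits.PneNP.PneNP.Theorems.ChebyshevTracialDesignBinomialMomentSums
import HarnessLib

/-!
# Cell pnp-psdrank, route `ChebyshevTracialDesign`: column sums of a harmonic layer over EVERY level class of a
# perfect matching — the exact bi-mode coefficients (★) by binomial inversion

Harmonic backbone, brick 7 (MEMO-7 §1 (1f), the `A`-basis). Rothvoß's level kernels `A_c(U,M) = 1[cc(U,M) = c]`
[cite: Rothvoss2017, §2 (PDF p. 6)] are the binomial inverse of the moment kernels `E^{(a)}(U,M) = C(e(U,M), a)`
(`e = (|U| − cc)/2` = number of matching edges inside `U`): `1[e = e₀] = Σ_a (−1)^{a−e₀} C(a,e₀) C(e,a)`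
(`ite_eq_alternating_choose`). Hence, from the `E`-basis column sums (`…BinomialMomentSums`, p441980), for a
Johnson-harmonic `p` of degree `k` and every level:
* `level_column_sum_zeta_eq_zero_of_odd` : `Σ_{|U| = 2l+1, e_π(U) = e₀} zeta p (U) = 0` for odd `k` — EVERY level kernel kills
  the odd Johnson layers (route vocabulary: `level_column_sum_cc_eq_zero_of_odd`, `Σ_{|U| = t, cc(U,M) = c} zeta p (U) = 0`);
* `level_column_sum_zeta_eq_of_even` : for `k = 2κ` it equals `σ̃ · Σ_{T closed, |T| = 2κ} p_T` with the explicit alternating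
  coefficient `σ̃ = Σ_{a ≥ max(e₀,κ)} (−1)^{a−e₀} C(a,e₀) · [Π_{i<t−2a}(n−2a−2κ−i)/(t−2a)!] · C(n/2−2κ, a−κ)` — MEMO-7 (★):
  all level kernels map the even layer onto the SAME matching-side functional `Π_p` (rank one in the level), with the
  half-degree-in-`c` profile coefficients verified numerically (n ≤ 12 entrywise; p1's σ_k at n = 80).
[cite: GodsilMeagher2015, §15.2 (perfect matching scheme)] WHAT THIS IS NOT: no eigenvalue count (eng g7 (R1)); nothing on
psd rank. Supports crux stmt-PneNP-19878.
-/

set_option linter.dupNamespace false -- `Summit.PneNP.PneNP.…`: summit = sub-problem (D-0017)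

noncomputable section

namespace Summit.PneNP.PneNP.Theorems.ChebyshevTracialDesignLevelColumnSums

open Finset Literature.Combinatorics.AssociationSchemes Literature.Combinatorics.AssociationSchemes.JohnsonHarmonics
open Literature.Barriers.PneNP
open Summit.PneNP.PneNP.Theorems.ChebyshevTracialDesignMatchingClosedSums
open Summit.PneNP.PneNP.Theorems.ChebyshevTracialDesignInvolutionKeys
open Summit.PneNP.PneNP.Theorems.ChebyshevTracialDesignSaturatedSubsets
open Summit.PneNP.PneNP.Theorems.ChebyshevTracialDesignBinomialMomentSums
open Summit.PneNP.PneNP.Theorems.ChebyshevTracialDesignTightColumnSums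

variable {n : ℕ}

/-! ### §1 Binomial inversion -/

/-- `Σ_{i < m'} (−1)^i C(m, i) = [m = 0]` for `m < m'` (the extra terms vanish). -/
theorem alternating_sum_choose_eq (m m' : ℕ) (hm : m < m') :
    ∑ i ∈ range m', (-1 : ℝ) ^ i * (m.choose i : ℝ) = if m = 0 then 1 else 0 := by
  rw [← sum_subset (range_subset_range.2 (show m + 1 ≤ m' by omega))]
  · have h := Int.alternating_sum_range_choose (n := m)
    have h' : ((∑ i ∈ range (m + 1), ((-1) ^ i * (m.choose i : ℤ)) : ℤ) : ℝ) = ((if m = 0 then 1 else 0 : ℤ) : ℝ) := by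
      rw [h]
    push_cast at h'
    rw [h']
  · intro i _ hi
    rw [mem_range, not_lt] at hi
    rw [Nat.choose_eq_zero_of_lt (by omega)]; simp

/-- **Binomial inversion of the moment kernels**: for `e < L`,
`[e = e₀] = Σ_{a < L} [e₀ ≤ a] (−1)^{a−e₀} C(a,e₀) C(e,a)`. -/
theorem ite_eq_alternating_choose (e e₀ L : ℕ) (he : e < L) :
    (if e = e₀ then (1 : ℝ) else 0) =
      ∑ a ∈ range L, if e₀ ≤ a then (-1 : ℝ) ^ (a - e₀) * (a.choose e₀ : ℝ) * (e.choose a : ℝ) else 0 := by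
  by_cases he₀ : e₀ ≤ e
  · -- split `range L` at `e₀` and shift
    obtain ⟨m, rfl⟩ := Nat.exists_eq_add_of_le he₀
    have hsplit := (sum_range_add_sum_Ico (fun a => if e₀ ≤ a then (-1 : ℝ) ^ (a - e₀) * (a.choose e₀ : ℝ) *
        ((e₀ + m).choose a : ℝ) else 0) (show e₀ ≤ L by omega)).symm
    rw [hsplit]
    have h0 : ∑ a ∈ range e₀, (if e₀ ≤ a then (-1 : ℝ) ^ (a - e₀) * (a.choose e₀ : ℝ) * ((e₀ + m).choose a : ℝ) else 0) = 0 :=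
      sum_eq_zero fun a ha => by rw [mem_range] at ha; rw [if_neg (by omega)]
    rw [h0, zero_add, sum_Ico_eq_sum_range]
    have hterm : ∀ i ∈ range (L - e₀),
        (if e₀ ≤ e₀ + i then (-1 : ℝ) ^ (e₀ + i - e₀) * ((e₀ + i).choose e₀ : ℝ) * ((e₀ + m).choose (e₀ + i) : ℝ) else 0) =
        ((e₀ + m).choose e₀ : ℝ) * ((-1 : ℝ) ^ i * (m.choose i : ℝ)) := by
      intro i _
      rw [if_pos (Nat.le_add_right _ _), Nat.add_sub_cancel_left]
      have h := Nat.choose_mul (n := e₀ + m) (k := e₀ + i) (s := e₀) (Nat.le_add_right _ _)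
      rw [Nat.add_sub_cancel_left, Nat.add_sub_cancel_left] at h
      have h' : (((e₀ + m).choose (e₀ + i) : ℕ) : ℝ) * ((e₀ + i).choose e₀ : ℝ) =
          ((e₀ + m).choose e₀ : ℝ) * (m.choose i : ℝ) := by exact_mod_cast h
      calc (-1 : ℝ) ^ i * ((e₀ + i).choose e₀ : ℝ) * ((e₀ + m).choose (e₀ + i) : ℝ)
          = (-1 : ℝ) ^ i * ((((e₀ + m).choose (e₀ + i) : ℕ) : ℝ) * ((e₀ + i).choose e₀ : ℝ)) := by ring
        _ = _ := by rw [h']; ring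
    rw [sum_congr rfl hterm, ← mul_sum, alternating_sum_choose_eq m (L - e₀) (by omega)]
    by_cases hm : m = 0
    · subst hm; simp
    · rw [if_neg hm, if_neg (by omega), mul_zero]
  · rw [if_neg (by omega)]
    symm
    refine sum_eq_zero fun a _ => ?_
    split_ifs with ha
    · rw [Nat.choose_eq_zero_of_lt (show e < a by omega)]; simp
    · rfl

/-! ### §2 Column sums over a level class -/

section Invol

variable {π : Fin n → Fin n} (hinv : ∀ x, π (π x) = x) (hfix : ∀ x, π x ≠ x)
include hinv hfix

/-- The number of inner keys of a `(2l+1)`-set is at most `l`. -/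
theorem innerKeys_le {l : ℕ} {U : Finset (Fin n)} (hU : U.card = 2 * l + 1) :
    (U.filter fun x => x < π x ∧ π x ∈ U).card ≤ l := by
  have h1 := two_mul_card_innerKeys hinv hfix U
  have h2 := card_filter_le U (fun x => π x ∈ U)
  omega

/-- **Level sums as alternating combinations of moment sums**: for any weight `f` on the `(2l+1)`-sets,
`Σ_{e_π(U) = e₀} f(U) = Σ_{a ≤ l} [e₀ ≤ a] (−1)^{a−e₀} C(a,e₀) · Σ_U C(e_π(U), a) f(U)`. -/
theorem levelSum_eq_alternating_momentSum (f : Finset (Fin n) → ℝ) (l e₀ : ℕ) :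
    ∑ U ∈ (powersetCard (2 * l + 1) (univ : Finset (Fin n))).filter
        (fun U => (U.filter fun x => x < π x ∧ π x ∈ U).card = e₀), f U =
      ∑ a ∈ range (l + 1), (if e₀ ≤ a then (-1 : ℝ) ^ (a - e₀) * (a.choose e₀ : ℝ) else 0) *
        ∑ U ∈ powersetCard (2 * l + 1) (univ : Finset (Fin n)),
          ((((U.filter fun x => x < π x ∧ π x ∈ U).card).choose a : ℕ) : ℝ) * f U := by
  rw [sum_filter]
  simp_rw [mul_sum]
  rw [sum_comm]
  refine sum_congr rfl fun U hU => ?_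
  have he := innerKeys_le hinv hfix (l := l) (mem_powersetCard.1 hU).2
  have hI := ite_eq_alternating_choose ((U.filter fun x => x < π x ∧ π x ∈ U).card) e₀ (l + 1) (by omega)
  calc (if (U.filter fun x => x < π x ∧ π x ∈ U).card = e₀ then f U else 0)
      = (if (U.filter fun x => x < π x ∧ π x ∈ U).card = e₀ then (1 : ℝ) else 0) * f U := by
        split_ifs <;> simp
    _ = (∑ a ∈ range (l + 1), if e₀ ≤ a then (-1 : ℝ) ^ (a - e₀) * (a.choose e₀ : ℝ) *
          (((U.filter fun x => x < π x ∧ π x ∈ U).card).choose a : ℝ) else 0) * f U := by rw [hI]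
    _ = _ := by
        rw [sum_mul]
        refine sum_congr rfl fun a _ => ?_
        split_ifs <;> ring

/-- Moment sums below the degree vanish: for `p` harmonic of degree `k` and `2a < k`,
`Σ_U C(e_π(U), a) · zeta p (U) = 0` (`zeta p` vanishes on the closed `2a`-sets, which are too small). -/
theorem momentSum_zeta_eq_zero_of_lt {k : ℕ} {p : Finset (Fin n) → ℝ} (hp : IsHarmonic k p) {t a : ℕ}
    (hak : 2 * a < k) :
    ∑ U ∈ powersetCard t (univ : Finset (Fin n)),
        ((((U.filter fun x => x < π x ∧ π x ∈ U).card).choose a : ℕ) : ℝ) * zeta p U = 0 := by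
  rw [momentSum_eq_closedSum_supersets hinv hfix]
  refine sum_eq_zero fun V hV => ?_
  have hVc : V.card = 2 * a := (mem_powersetCard.1 (mem_filter.1 hV).1).2
  by_cases hat : 2 * a ≤ t
  · obtain ⟨j, hj⟩ : ∃ j, t = 2 * a + j := ⟨t - 2 * a, by omega⟩
    have h := sum_supersets_zeta_iter hp V j
    rw [zeta_of_isHomog_of_card_lt hp.1 (by rw [hVc]; omega), mul_zero, hVc, ← hj] at h
    exact (mul_eq_zero.1 h).resolve_left (by positivity)
  · have : (powersetCard t (univ : Finset (Fin n))).filter (fun U => V ⊆ U) = ∅ := by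
      refine filter_eq_empty_iff.2 fun U hU hVU => ?_
      have := card_le_card hVU
      rw [(mem_powersetCard.1 hU).2, hVc] at this
      omega
    rw [this, sum_empty]

/-! ### §3 Level column sums of a harmonic layer -/

/-- **Every level kernel kills the odd Johnson layers.** For `p` harmonic of odd degree `k` and every level class
`e_π(U) = e₀` of the `(2l+1)`-cuts: `Σ_{|U| = 2l+1, e_π(U) = e₀} zeta p (U) = 0`. -/
theorem level_column_sum_zeta_eq_zero_of_odd {k : ℕ} (hk : Odd k) {p : Finset (Fin n) → ℝ} (hp : IsHarmonic k p)
    (l e₀ : ℕ) :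
    ∑ U ∈ (powersetCard (2 * l + 1) (univ : Finset (Fin n))).filter
        (fun U => (U.filter fun x => x < π x ∧ π x ∈ U).card = e₀), zeta p U = 0 := by
  rw [levelSum_eq_alternating_momentSum hinv hfix]
  refine sum_eq_zero fun a ha => ?_
  rw [momentSum_zeta_eq_zero_of_odd hinv hfix hk hp (by have := mem_range.1 ha; omega), mul_zero]

/-- **The exact bi-mode coefficient (★).** For `p` harmonic of degree `2κ` (`4κ ≤ n`) and every level class `e_π(U) = e₀`
of the `(2l+1)`-cuts: `Σ_{|U| = 2l+1, e_π(U) = e₀} zeta p (U) = σ̃ · Σ_{T closed, |T| = 2κ} p_T` with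
`σ̃ = Σ_{κ, e₀ ≤ a ≤ l} (−1)^{a−e₀} C(a,e₀) · (Π_{i < 2l+1−2a} (n − 2a − 2κ − i)) / (2l+1−2a)! · C(n/2 − 2κ, a − κ)`. -/
theorem level_column_sum_zeta_eq_of_even {κ : ℕ} (hκn : 4 * κ ≤ n) {p : Finset (Fin n) → ℝ}
    (hp : IsHarmonic (2 * κ) p) (l e₀ : ℕ) :
    ∑ U ∈ (powersetCard (2 * l + 1) (univ : Finset (Fin n))).filter
        (fun U => (U.filter fun x => x < π x ∧ π x ∈ U).card = e₀), zeta p U =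
      (∑ a ∈ range (l + 1), if e₀ ≤ a ∧ κ ≤ a then
          (-1 : ℝ) ^ (a - e₀) * (a.choose e₀ : ℝ) *
            ((∏ i ∈ range (2 * l + 1 - 2 * a), ((n : ℝ) - (2 * a : ℕ) - (2 * κ : ℕ) - i)) /
              ((2 * l + 1 - 2 * a).factorial : ℝ)) *
            (((((univ : Finset (Fin n)).filter fun x => x < π x).card - 2 * κ).choose (a - κ) : ℕ) : ℝ)
        else 0) *
        ∑ T ∈ univ.filter (fun T : Finset (Fin n) => (T.filter fun x => π x ∈ T).card = 2 * κ), p T := by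
  rw [levelSum_eq_alternating_momentSum hinv hfix, sum_mul]
  refine sum_congr rfl fun a ha => ?_
  have hal : a ≤ l := by have := mem_range.1 ha; omega
  by_cases hκa : κ ≤ a
  · -- the moment sum from brick 6 with `j = 2l + 1 - 2a`
    obtain ⟨j, hj⟩ : ∃ j, 2 * l + 1 = 2 * a + j := ⟨2 * l + 1 - 2 * a, by omega⟩
    have hm := momentSum_zeta_eq_of_even hinv hfix hκn hp (a := a) (j := j) hκa
    rw [← hj] at hm
    have hjf : ((j.factorial : ℕ) : ℝ) ≠ 0 := by positivity
    have hM : ∑ U ∈ powersetCard (2 * l + 1) (univ : Finset (Fin n)),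
        ((((U.filter fun x => x < π x ∧ π x ∈ U).card).choose a : ℕ) : ℝ) * zeta p U =
        ((∏ i ∈ range j, ((n : ℝ) - (2 * a : ℕ) - (2 * κ : ℕ) - i)) / (j.factorial : ℝ)) *
          ((((((univ : Finset (Fin n)).filter fun x => x < π x).card - 2 * κ).choose (a - κ) : ℕ) : ℝ) *
            ∑ T ∈ univ.filter (fun T : Finset (Fin n) => (T.filter fun x => π x ∈ T).card = 2 * κ), p T) := by
      rw [div_mul_eq_mul_div, eq_div_iff (by exact_mod_cast hjf), mul_comm]
      exact_mod_cast hm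
    rw [hM, show 2 * l + 1 - 2 * a = j by omega]
    by_cases he : e₀ ≤ a
    · rw [if_pos he, if_pos ⟨he, hκa⟩]; ring
    · rw [if_neg he, if_neg (fun h => he h.1)]; ring
  · push Not at hκa
    rw [momentSum_zeta_eq_zero_of_lt hinv hfix hp (by omega), mul_zero, if_neg (fun h => (by omega : ¬ κ ≤ a) h.2),
      zero_mul]

end Invol

/-! ### §4 In the route's vocabulary: every level kernel `1[cc(U,M) = c]` kills the odd layers -/

/-- **All level kernels of Rothvoß's slack matrix annihilate the odd Johnson layers**: for every perfect matching `M`,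
odd cut size `t`, level `c`, and Johnson-harmonic `p` of odd degree, `Σ_{|U| = t, cc(U,M) = c} zeta p (U) = 0`. -/
theorem level_column_sum_cc_eq_zero_of_odd (M : PMatch n) {t : ℕ} (ht : Odd t) (c : ℕ) {k : ℕ} (hk : Odd k)
    {p : Finset (Fin n) → ℝ} (hp : IsHarmonic k p) :
    ∑ U ∈ univ.filter (fun U : OddSet n => U.1.card = t ∧ cc U M = c), zeta p U.1 = 0 := by
  classical
  obtain ⟨l, rfl⟩ := ht
  -- translate `cc = c` into the inner-key count `e = (t - c)/2` (and `c ≤ t`, parity)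
  by_cases hc : c ≤ 2 * l + 1 ∧ (2 * l + 1 - c) % 2 = 0
  · have hfilter : univ.filter (fun U : OddSet n => U.1.card = 2 * l + 1 ∧ cc U M = c) =
        univ.filter (fun U : OddSet n => U.1.card = 2 * l + 1 ∧
          (U.1.filter fun x => x < M.2.partner x ∧ M.2.partner x ∈ U.1).card = (2 * l + 1 - c) / 2) := by
      refine filter_congr fun U _ => ?_
      have h := card_eq_cc_add U M
      constructor
      · rintro ⟨h1, h2⟩; refine ⟨h1, ?_⟩; rw [h1, h2] at h; omega
      · rintro ⟨h1, h2⟩; refine ⟨h1, ?_⟩; rw [h1, h2] at h; omega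
    rw [hfilter, sum_oddSet_eq_sum_powersetCard ⟨l, rfl⟩
      (fun U => (U.filter fun x => x < M.2.partner x ∧ M.2.partner x ∈ U).card = (2 * l + 1 - c) / 2) (fun U => zeta p U)]
    exact level_column_sum_zeta_eq_zero_of_odd (partner_invol M).1 (partner_invol M).2 hk hp l _
  · -- no cut has this level: the class is empty
    refine sum_eq_zero fun U hU => ?_
    exfalso
    simp only [mem_filter, mem_univ, true_and] at hU
    have h := card_eq_cc_add U M
    rw [hU.1, hU.2] at h
    apply hc
    omega

end Summit.PneNP.PneNP.Theorems.ChebyshevTracialDesignLevelColumnSums
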